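import Literature.NumberTheory.LFunctions.LevelOneCentralValuesWeightAspect
import HarnessLib

/-!
LANDING NOTE (typer ls-idea-typ-1 gen 1, cell ls-idea): card K-I3-4 «WEIGHT k IS THE EXTRA AVERAGING
VARIABLE — the located object beyond Δ = 1» (seat ls-idea-lens-3 gen 1; critic A PASS as LOCATION
«object + wall named in a third family; no wall crossing claimed»; B/C successors pending; the author
deferred the typing request to the desk, desk `CARDS.md` §1b lists it). Typed as the weight-aspect
TWIN of `KMV2000.MomentAsymptotics` (`KMVMomentAsymptoticsBeyondDiagonal.lean`) over the tree's
Balkanova–Frolenkov vocabulary (`LevelOneCentralValues.weightAverage/harmonicSum/mollifierValue/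
centralValue`, Lemmas 8.4/8.6 as named facts): a PREDICATE in the length window with two extra
main-term tables, the PRINTED range `Δ < 1` repackaged (proved from the two named facts taken as
hypotheses), and the card's located object «K_A of the weight family» as a PARAMETRIC shape. Nothing
beyond `Δ < 1` is asserted. «The programme SEARCHES and TYPES; no claim about Landau–Siegel zeros,
Theorems 1–2 of arXiv:2211.02515 or a repaired Margin232 until a kernel theorem says so.»

## References
* [BalkanovaFrolenkov2021] O. Balkanova, D. Frolenkov, J. Eur. Math. Soc. 23 (2021) = arXiv:1610.03465
  (v3), §7 (7.1)–(7.4), §8 Lemmas 8.4, 8.6 (shape of the two weight-averaged displays, range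
  `Δ < 1 − ε`), Lemma 7.1 / Thm 7.4 (exact formula), p. 17 L77–L100, p. 18 L44–L60, p. 21 L1–L25.
  [held: paper:arxiv-1610.03465 p0003, p0017–p0018, p0021]
* [KowalskiMichelVanderKam2000] J. reine angew. Math. 526 (2000), p. 28 L73–L77 («Δ beyond 1»,
  the prime-level counterpart).

# Weight aspect, level one: the k-AVERAGED mollified-moment asymptotics as a predicate in the length
# window, the printed range `Δ < 1`, and the located object beyond `Δ = 1` (card K-I3-4)

Family: `f ∈ H_{4k}(1)`, weights `4k ≍ K` smoothly weighted by `h(4k/K)` (§7 test functions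
`IsWeightTest`), harmonic weights, mollifier `M(f)` of (8.1) with `P = X²` hard-wired
(`mollifierCoeff`) and length `M = K^Δ`. Balkanova–Frolenkov's EXACT kernel (Lemma 7.1, no Petersson
error term) localises the off-diagonal and gives both displays for `Δ < 1 − ε` (Lemmas 8.4, 8.6:
main terms `(HK/4)·4ζ(2)/log M` and `(HK/4)·16ζ(2)²(1+1/Δ)/log² M`). Card K-I3-4 LOCATES what a
window `Δ > 1` would require in this family: ONE short-shift Möbius autocorrelation / binary
additive-divisor sum in the band `a ≈ √L`, shifts `N = K^{2Δ−2}` — GRH-immune, world-independent,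
beyond DFI/shifted-convolution technology (barrier note B-I3-3: (A)-pollution threshold polylog(K)).
This file types the WINDOW predicate with extra tables `T₁ T₂ : ℝ → ℝ` (functions of `Δ` only, since
`P`, `Q` are fixed in this vocabulary) and the located object; it proves only the repackaging of the
printed range. Definitions + bookkeeping; nothing asserted.
-/

noncomputable section

open scoped Classical
open Complex

namespace Literature.NumberTheory.LFunctions

namespace LevelOneCentralValues

/-- **Weight-averaged mollified-moment asymptotics on the length window `(Δlo, Δhi]`** (the
weight-aspect twin of `KMV2000.MomentAsymptotics`): for every §7 test function `h` and every
`Δ ∈ (Δlo, Δhi]`, for all large `K`, the `h(4k/K)`-averaged harmonic FIRST and SECOND mollified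
moments at mollifier length `M = K^Δ` have main terms `(HK/4)·(4ζ(2) + T₁(Δ))/log M` and
`(HK/4)·(16ζ(2)²(1+1/Δ) + T₂(Δ))/log² M` with errors `O(K log⁻² M)`, `O(K log⁻³ M)` — the shape of
Balkanova–Frolenkov Lemmas 8.4/8.6, with `T₁, T₂` the additional (off-diagonal) main-term tables a
window beyond the diagonal would require (`0` in print, `Δ < 1`). A PREDICATE; which instances are in
print: `weightAspectMomentAsymptotics_printed`. [cite: BalkanovaFrolenkov2021, Lemmas 8.4 and 8.6 (shape of the two displays)] -/
def WeightAspectMomentAsymptotics (Δlo Δhi : ℝ) (T₁ T₂ : ℝ → ℝ) : Prop :=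
  ∀ h : ℝ → ℝ, IsWeightTest h → ∀ Δ : ℝ, Δlo < Δ → Δ ≤ Δhi →
    ∃ K₀ C : ℝ, ∀ K : ℝ, K₀ ≤ K →
      ‖weightAverage h K (fun k =>
            harmonicSum (4 * (k : ℤ)) (fun f => mollifierValue (K ^ Δ) f * centralValue f)) -
          ((weightMass h * K / 4 * ((4 * zetaTwo + T₁ Δ) / Real.log (K ^ Δ)) : ℝ) : ℂ)‖ ≤
        C * K * (Real.log (K ^ Δ))⁻¹ ^ 2 ∧
      ‖weightAverage h K (fun k =>
            harmonicSum (4 * (k : ℤ))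
              (fun f => mollifierValue (K ^ Δ) f ^ 2 * centralValue f ^ 2)) -
          ((weightMass h * K / 4 *
              ((16 * zetaTwo ^ 2 * (1 + 1 / Δ) + T₂ Δ) / Real.log (K ^ Δ) ^ 2) : ℝ) : ℂ)‖ ≤
        C * K * (Real.log (K ^ Δ))⁻¹ ^ 3

/-- The DIAGONAL-ONLY weight-aspect shape on a window (no extra tables). In print for windows inside
`(0, 1)`; beyond `Δ = 1` it is nobody's theorem. [cite: BalkanovaFrolenkov2021, Lemmas 8.4 and 8.6 (range Δ < 1 − ε)] -/
def WeightAspectMomentAsymptoticsDiagOnly (Δlo Δhi : ℝ) : Prop :=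
  WeightAspectMomentAsymptotics Δlo Δhi (fun _ ↦ 0) (fun _ ↦ 0)

/-- **The printed range (proved repackaging).** Balkanova–Frolenkov Lemmas 8.4 and 8.6 (named facts
`balkanovaFrolenkov2021_lemma84/86`, taken as hypotheses) give the diagonal-only weight-aspect
asymptotics on every window `(Δlo, Δhi]` with `0 ≤ Δlo` and `Δhi < 1` (apply the lemmas with
`ε := (1 − Δhi)/2`). [cite: BalkanovaFrolenkov2021, Lemmas 8.4 and 8.6 (range 0 < Δ < 1 − ε)] -/
theorem weightAspectMomentAsymptotics_printed (h84 : balkanovaFrolenkov2021_lemma84)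
    (h86 : balkanovaFrolenkov2021_lemma86) {Δlo Δhi : ℝ} (hlo : 0 ≤ Δlo) (hhi : Δhi < 1) :
    WeightAspectMomentAsymptoticsDiagOnly Δlo Δhi := by
  intro h hh Δ hΔlo hΔhi
  have hΔ0 : 0 < Δ := lt_of_le_of_lt hlo hΔlo
  have hε : 0 < (1 - Δhi) / 2 := by linarith
  have hΔ1 : Δ < 1 - (1 - Δhi) / 2 := by linarith
  obtain ⟨K₁, C₁, H₁⟩ := h84 h hh _ Δ hε hΔ0 hΔ1
  obtain ⟨K₂, C₂, H₂⟩ := h86 h hh _ Δ hε hΔ0 hΔ1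
  refine ⟨max (max K₁ K₂) 2, max C₁ C₂, fun K hK ↦ ?_⟩
  have hK₁ : K₁ ≤ K := le_trans (le_trans (le_max_left _ _) (le_max_left _ _)) hK
  have hK₂ : K₂ ≤ K := le_trans (le_trans (le_max_right _ _) (le_max_left _ _)) hK
  have hK2 : (2 : ℝ) ≤ K := le_trans (le_max_right _ _) hK
  have hK0 : 0 ≤ K := by linarith
  have hlog : 0 < Real.log (K ^ Δ) := by
    rw [Real.log_rpow (by linarith)]
    exact mul_pos hΔ0 (Real.log_pos (by linarith))
  have hinv : 0 ≤ (Real.log (K ^ Δ))⁻¹ := le_of_lt (inv_pos.2 hlog)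
  refine ⟨?_, ?_⟩
  · have e := H₁ K hK₁
    simp only [add_zero] at e ⊢
    exact e.trans (mul_le_mul_of_nonneg_right
      (mul_le_mul_of_nonneg_right (le_max_left _ _) hK0) (sq_nonneg _))
  · have e := H₂ K hK₂
    have emt : weightMass h * K / 4 * (16 * zetaTwo ^ 2 / Real.log (K ^ Δ) ^ 2 * (1 + 1 / Δ)) =
        weightMass h * K / 4 * (16 * zetaTwo ^ 2 * (1 + 1 / Δ) / Real.log (K ^ Δ) ^ 2) := by
      ring
    rw [emt] at e
    simp only [add_zero] at e ⊢
    exact e.trans (mul_le_mul_of_nonneg_right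
      (mul_le_mul_of_nonneg_right (le_max_right _ _) hK0) (pow_nonneg hinv 3))

/-- **Card K-I3-4's located object: «K_A of the weight family» at reach `Δhi`** — weight-averaged
mollified-moment asymptotics on the window `(1, Δhi]` with SOME tables `T₁ T₂ : ℝ → ℝ` (functions of
the length exponent only). For `Δhi > 1` this is NOT in print: beyond `Δ = 1` the off-diagonal is the
card's short-shift Möbius autocorrelation / binary additive-divisor sum in the `√L` band with shifts
`N = K^{2Δ−2}` (GRH-immune; barrier note B-I3-3); nearest print stops at `Δ < 1` (Lemma 8.6) resp.
`M < K^{2−ε}` for the first moment (Balkanova–Frolenkov 2017). The weight-aspect counterpart of route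
`PrimeLevelFamEdge`'s K_A `MomentsBeyondDiagonal`; the card claims LOCATION only (no wall crossing).
A PREDICATE in `Δhi`; never asserted; typed ≠ proved. [cite: BalkanovaFrolenkov2021, Lemma 8.6 (shape; printed range Δ < 1 − ε only)]
[cite: KowalskiMichelVanderKam2000, p. 28 L73–L77] -/
def WeightAspectMomentsBeyondDiagonal (Δhi : ℝ) : Prop :=
  ∃ T₁ T₂ : ℝ → ℝ, WeightAspectMomentAsymptotics 1 Δhi T₁ T₂

/-- Bookkeeping (proved): the located object is monotone in the reach — a window `(1, Δhi]` contains
every `(1, Δhi']` with `Δhi' ≤ Δhi`. [cite: BalkanovaFrolenkov2021, Lemma 8.6 (shape)] -/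
theorem WeightAspectMomentsBeyondDiagonal.anti {Δhi Δhi' : ℝ} (hle : Δhi' ≤ Δhi)
    (h : WeightAspectMomentsBeyondDiagonal Δhi) : WeightAspectMomentsBeyondDiagonal Δhi' := by
  obtain ⟨T₁, T₂, H⟩ := h
  exact ⟨T₁, T₂, fun g hg Δ h1 h2 ↦ H g hg Δ h1 (le_trans h2 hle)⟩

end LevelOneCentralValues

end Literature.NumberTheory.LFunctions
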